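/-
Origin: expansion seat `planner-pub-hodgecm-pv09-g5-0`, handover #3 2026-08-18T09:23:54Z (`HOME/pub-hodgecm-pv09-g5/lean/Pv09g5/GenuineHeadlineBase.lean`, md5 ba7a8601, 261 lines);
landed by the gen-7 packager in gate run 27 as `HodgeCM/PerL34/GenuineHeadlineBase.lean` (import ^import Pv[0-9]+g[0-9]+\.→import HodgeCM.PerL34. ×2).
-/
/-
Copyright: HodgeCM publication cell (pub-hodgecm), DAG node N31 (seam S3, PerL v5 Lemma 4.2(b)) — the S3 headline
for the GENUINE unitary torus with coefficient field `L⁺` = print's `L_0 := L ∩ ℝ` (tex l. 47), to the letter of tex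
l. 610 "`\U(W_i)(L_{0,v})` is compact unless `v` splits in `L`, where it is `L_{0,v}^\times`", and
the D4 (b) dictionary in print shape.  Prover seat pub-hodgecm-pv09-g5 (DAG-node prover #09, generation 5; lineage
pv09 → g2 → g3 → g4 → g5), file #3 (HANDOVER #3).  Released under the package licence.

WIP imports: `Pv09g5.GenuineIntertwiner` ↦ `HodgeCM.PerL34.GenuineIntertwiner` (this seat, HANDOVER #2, run 27/28);
`Pv07g3.LocTorusSplitBase` ↦ `HodgeCM.PerL34.LocTorusSplitBase` (pv07-g3 HANDOVER #3, run 27/28); tree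
`HodgeCM.PerL34.IdentificationEnd` (pv13-g3, run 26).  Complete proofs, no new axioms, nothing cited.
-/
import Summits.HodgeConjecture.HodgeCM.PerL34.GenuineIntertwiner
import Summits.HodgeConjecture.HodgeCM.PerL34.LocTorusSplitBase_2
import Summits.HodgeConjecture.HodgeCM.PerL34.IdentificationEnd

/-!
# The S3 headline for `U(1)_{L/L⁺}(𝔸_{L⁺})` over the BASE completions `L⁺_v`

`GenuineHeadline` (#1) / `GenuineIntertwiner` (#2) state the S3 headline for the genuine torus of a CM field `L`
with the split local groups read in `L_w` (`w` the chosen place over `v`; `Genuine.splitTriv v : U(1)_v ≃ₜ* L_wˣ`),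
i.e. with coefficient field `L₀ := L`.  Print (PerL v5 tex l. 610) writes "`\U(W_i)(L_{0,v})` … where it is
`L_{0,v}^\times`" with `L_0 := L ∩ ℝ` (l. 47) `= L⁺`: the coefficient field is the BASE field.  pv07-g3's `LocTorusSplitBase` (residual (d2′)) supplies, at a split
place, the identification of completions `L⁺_v = L_w` (`e = f = 1`) and the chart
`splitEquivBaseCM : U(1)_v ≃ₜ* (L⁺_v)ˣ` carrying the level onto `𝒪_vˣ = {‖·‖ = 1}`.

This file feeds that chart into pv09-g4's model headline with `L₀ := L⁺`, `w := Genuine.basePlaceOf`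
(`inr v ↦ v`), the valuation data `ord_v`, `ϖ_v`, `ϖ^F_v` DERIVED from the chart (pv13-g3 `IdentificationEnd`:
`ordOfIdent`, `unifOfIdent`, tree `Adic.exists_isUniformizer`), and the dictionary in the intertwiner shape of #2
(tree `SplitShells.coeff_zpow_of_intertwiner` / `coeffS_of_intertwiner`).

**Result** `PureTensor.exists_compactDomain_thetaLift_ne_zero_genuine_base`: the conclusion of #1 verbatim, from
representation-side binders typed over the base completions: `ν_v : (L⁺_v)ˣ →* U(1)` (unramified at split
`v ∉ S`), isometric intertwiners `VU_v / VS_v : L²((L⁺_v)³) →ₗᵢ Sp` along `Genuine.baseTriv v : U(1)_v ≃ₜ* (L⁺_v)ˣ`,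
the ball / scalar choice `x₀ r a` on `S`, isotypy `hiso` at the non-split places of `S`; plus `hS` and the
instance binders (now on the completions of `L⁺`).  NO identification datum remains.

Nothing is cited; PerL v5 ll. 600–640 is the USE of this statement.
-/

set_option autoImplicit false

noncomputable section

open MeasureTheory MeasureTheory.Measure Set Metric Function Complex ComplexConjugate Topology
open scoped RestrictedProduct InnerProductSpace NNReal ENNReal

/-! ## §1  Base place data of the genuine torus -/

namespace HodgeCM.PerL34.IdelicTorusModel

namespace Genuine

open IdelePlaces RestrictedRegroup RestrictedCutout NumberField IsDedekindDomain Sum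
open HodgeCM.PerL34.LocalFactors.DilationModel

attribute [local instance] LocalFactors.DilationModel.Adic.nontriviallyNormedField
  LocalFactors.DilationModel.Adic.properSpace

variable (L : Type) [Field L] [NumberField L] [IsCMField L]

local notation3 "L⁺" => maximalRealSubfield L

/-- `basePlaceOf i`: the finite place of the BASE field `L⁺` attached to the index `i` (the END's `w i` for
`L₀ := L⁺`): `v` itself at a finite `v`, an arbitrary finite place at an infinite index (never used there). -/
def basePlaceOf : Place L⁺ → HeightOneSpectrum (𝓞 L⁺)
  | inl _ => ((nonempty_heightOneSpectrum L).some).under (𝓞 L⁺)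
  | inr v => v

omit [IsCMField L] in
/-- (Ported verbatim from the HodgeCMPerL package; no docstring in the source.) -/
@[simp] theorem basePlaceOf_inr (v : HeightOneSpectrum (𝓞 L⁺)) : basePlaceOf L (inr v) = v := rfl

omit [IsCMField L] in
/-- END binder `hw` for `L₀ := L⁺`: `basePlaceOf` is injective on the finite places. -/
theorem basePlaceOf_injOn {S : Finset (Place L⁺)} (hS : ∀ v : InfinitePlace L⁺, inl v ∈ S) :
    ∀ ⦃i j : Place L⁺⦄, i ∉ S → j ∉ S → basePlaceOf L i = basePlaceOf L j → i = j := by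
  rintro (x | v) (y | v') hi hj h
  · exact absurd (hS x) hi
  · exact absurd (hS x) hi
  · exact absurd (hS y) hj
  · exact congrArg inr h

/-- **The base chart at a split place**: `baseTriv v : U(1)_v ≃ₜ* (L⁺_v)ˣ` := pv07-g3 `splitEquivBaseCM` at the
chosen place `placeOver v` over `v` (tex l. 610 "`\U(W_i)(L_{0,v})` … is `L_{0,v}^\times`", `L_0 = L⁺`). -/
def baseTriv : ∀ (i : Place L⁺), IsSplitPlace L i → (locTorus L⁺ L i ≃ₜ* ((basePlaceOf L i).adicCompletion L⁺)ˣ)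
  | inl _, hs => hs.elim
  | inr v, hs => splitEquivBaseCM (L := L) hs (placeOver_under L v)

/-- END binder `hτUB` for the base chart: the level `B_v` is carried onto `𝒪_vˣ = {‖·‖ = 1} ⊂ (L⁺_v)ˣ`
(pv07-g3 `mem_inH_iff_norm_splitEquivBase_eq_one`). -/
theorem mem_genLevel_iff_norm_baseTriv_eq_one :
    ∀ (i : Place L⁺) (hs : IsSplitPlace L i) (g : locTorus L⁺ L i),
      g ∈ genLevel L i ↔ ‖((baseTriv L i hs g : ((basePlaceOf L i).adicCompletion L⁺)ˣ) :
        (basePlaceOf L i).adicCompletion L⁺)‖ = 1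
  | inl _, hs, _ => hs.elim
  | inr v, hs, g => by
    have key : ∀ {v' : HeightOneSpectrum (𝓞 L⁺)} (hwv : (placeOver L v).under (𝓞 L⁺) = v')
        (g : locTorus L⁺ L (inr v')),
        g ∈ inH (fun k => fibSubgroup (intUnits L) (pl L⁺ L) k) (locTorus L⁺ L) (inr v') ↔
          ‖((splitEquivBaseCM (L := L) hs hwv g : (v'.adicCompletion L⁺)ˣ) : v'.adicCompletion L⁺)‖ = 1 := by
      rintro _ rfl g
      exact mem_inH_iff_norm_splitEquivBase_eq_one (IsCMField.complexConj L) (eq_one_or_eq_complexConj (L := L)) hs g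
    exact key (placeOver_under L v) g

/-- `baseUnifF v`: a chosen uniformizer of `L⁺_v` (the END's `ϖF` for `L₀ := L⁺`; tree `Adic.exists_isUniformizer`). -/
def baseUnifF (v : HeightOneSpectrum (𝓞 L⁺)) : (v.adicCompletion L⁺)ˣ := (Adic.exists_isUniformizer L⁺ v).choose

omit [IsCMField L] in
/-- (Ported verbatim from the HodgeCMPerL package; no docstring in the source.) -/
theorem isUniformizer_baseUnifF (v : HeightOneSpectrum (𝓞 L⁺)) : IsUniformizer (baseUnifF L v) :=
  (Adic.exists_isUniformizer L⁺ v).choose_spec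

end Genuine

end HodgeCM.PerL34.IdelicTorusModel

/-! ## §2  The headline for `U(1)_{L/L⁺}` over the base completions -/

namespace HodgeCM.PerL34.PureTensor

open HodgeCM.PerL34.SplitShells HodgeCM.PerL34.AdelicFactorisation HodgeCM.PerL34.RestrictedMeasure
open HodgeCM.PerL34.NoSmallSubgroups HodgeCM.PerL34.EulerFactorisation HodgeCM.PerL34.DiscreteFD
open HodgeCM.PerL34.LocalFactors HodgeCM.PerL34.LocalFactors.DilationModel
open HodgeCM.PerL34.LocalModulus HodgeCM.PerL34.SplitPlaceDilation
open HodgeCM.PerL34.RallisIP HodgeCM.PerL34.Doubling HodgeCM.PerL34.N31d NumberField IsDedekindDomain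
open HodgeCM.PerL34.IdelePlaces HodgeCM.PerL34.RestrictedRegroup HodgeCM.PerL34.RestrictedCutout
open HodgeCM.PerL34.IdelicTorusModel HodgeCM.PerL34.IdelicTorusModel.Genuine

attribute [local instance] LocalFactors.DilationModel.Adic.nontriviallyNormedField
  LocalFactors.DilationModel.Adic.properSpace

section genuineBase

variable (L : Type) [Field L] [NumberField L] [IsCMField L]

-- (no `L⁺` notation in this section: a `notation3` token inside `variable` binders does not re-elaborate)

variable [DecidableEq (Place (maximalRealSubfield L))]
  [∀ v : HeightOneSpectrum (𝓞 (maximalRealSubfield L)), MeasurableSpace (v.adicCompletion (maximalRealSubfield L))]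
  [∀ v : HeightOneSpectrum (𝓞 (maximalRealSubfield L)), BorelSpace (v.adicCompletion (maximalRealSubfield L))]
  (S₀ : Finset (Place (maximalRealSubfield L)))
  {Sp : Type} [NormedAddCommGroup Sp] [InnerProductSpace ℂ Sp]
  {W : Type} [AddCommGroup W] [Module L W]
  {H Sbox : Type} [Group H] [AddCommGroup Sbox] [Module ℂ Sbox]
  {h : W →ₗ⋆[L] W →ₗ[L] L} (hW : IsLine L W) (hh : Anisotropic h)
  (D : DoublingDatum (Model L) H Sp Sbox) (GU : ThetaSide Sp Sbox)
  (j : isomBox h →* H) (hj : ∀ d : unitary L, j ⟨iotaSnd d, iotaSnd_mem h d⟩ = D.ι (1, unitaryToModel L d))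
  (χ : Model L →* Circle) (hχΓ : ∀ d : unitary L, χ (unitaryToModel L d) = 1)
  (hχVΓ : ∀ d : unitary L, D.χV (unitaryToModel L d) = 1)
  {hP : ∀ Ψ : Sbox, ∀ p ∈ (stabDelta L W).subgroupOf (isomBox h), ∀ x : H,
    D.fSW Ψ (j p * x) = D.fSW Ψ x}
  (P : GluePrintInputs D GU h j hP) (φ : Sp)
  (hφ : ‖φ‖ = 1)
  (hloc : ∀ (i : Place (maximalRealSubfield L)) (v : Sp),
    Continuous fun g : locTorus (maximalRealSubfield L) L i => D.ω (RestrictedProduct.mulSingle (genLevel L) i g) v)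
  {T' : Finset (Place (maximalRealSubfield L))} (hχT' : RestrictedProduct.boxSubgroup (genLevel L) T' ≤ χ.ker)
  (hlocχ : ∀ i ∈ T', Continuous fun g : locTorus (maximalRealSubfield L) L i => χ (RestrictedProduct.mulSingle (genLevel L) i g))
  {T : Finset (Place (maximalRealSubfield L))} (hK : ∀ k ∈ RestrictedProduct.boxSubgroup (genLevel L) T, D.ω k φ = φ)
  (hM : ∀ S : Finset (Place (maximalRealSubfield L)), T ⊆ S → ∀ y : (i : ↥S) → locTorus (maximalRealSubfield L) L i,
    inner ℂ φ (D.ω (extendOne (genLevel L) S y) φ) = ∏ i : ↥S, localCoeff (genLevel L) D.ω φ i (y i))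
  {S : Finset (Place (maximalRealSubfield L))} (hTS : T ⊆ S) (hT'S : T' ⊆ S)
  -- bookkeeping: `S` contains the infinite places
  (hS : ∀ v : InfinitePlace (maximalRealSubfield L), Sum.inl v ∈ S)
  -- the local unitary characters `ν_v` of `(L⁺_v)ˣ`, unramified off `S`
  (ν : ∀ i : Place (maximalRealSubfield L),
    ((basePlaceOf L i).adicCompletion (maximalRealSubfield L))ˣ →* Circle)
  (hν : ∀ i, i ∉ S → IsSplitPlace L i → ∀ u : ((basePlaceOf L i).adicCompletion (maximalRealSubfield L))ˣ,
    ‖(u : (basePlaceOf L i).adicCompletion (maximalRealSubfield L))‖ = 1 → ν i u = 1)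
  -- split `v ∉ S`: the INTERTWINER on `1_{𝒪_v³}` along the base chart `baseTriv`
  (VU : ∀ i, i ∉ S → IsSplitPlace L i →
    (Lp ℂ 2 (Adic.muV (maximalRealSubfield L) (basePlaceOf L i)) →ₗᵢ[ℂ] Sp))
  (hVUψ : ∀ i (hi : i ∉ S) (hs : IsSplitPlace L i),
    VU i hi hs (ballIndicator (Adic.muV (maximalRealSubfield L) (basePlaceOf L i)) 0 1) = φ)
  (hVU : ∀ i (hi : i ∉ S) (hs : IsSplitPlace L i), ∀ g : locTorus (maximalRealSubfield L) L i,
    D.ω (RestrictedProduct.mulSingle (genLevel L) i g)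
        (VU i hi hs (ballIndicator (Adic.muV (maximalRealSubfield L) (basePlaceOf L i)) 0 1))
      = VU i hi hs (dilationRep (Adic.muV (maximalRealSubfield L) (basePlaceOf L i)) (ν i) (baseTriv L i hs g)
          (ballIndicator (Adic.muV (maximalRealSubfield L) (basePlaceOf L i)) 0 1)))
  -- split `v ∈ S`: the ball `D = closedBall x₀ r` and scalar `a` (CHOICE), and the INTERTWINER on `a • 1_D`
  (x₀ : ∀ i : Place (maximalRealSubfield L), Fin 3 → (basePlaceOf L i).adicCompletion (maximalRealSubfield L))
  (r : Place (maximalRealSubfield L) → ℝ) (a : Place (maximalRealSubfield L) → ℂ)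
  (hr : ∀ i ∈ S, IsSplitPlace L i → r i < ‖x₀ i‖) (hr0 : ∀ i ∈ S, IsSplitPlace L i → 0 < r i)
  (hνS : ∀ i ∈ S, IsSplitPlace L i → ∀ y : ((basePlaceOf L i).adicCompletion (maximalRealSubfield L))ˣ,
    (y : (basePlaceOf L i).adicCompletion (maximalRealSubfield L)) ∈ U1 (x₀ i) (r i) → ν i y = 1)
  (hχS : ∀ i (_ : i ∈ S) (hs : IsSplitPlace L i), ∀ g : locTorus (maximalRealSubfield L) L i,
    ((baseTriv L i hs g : ((basePlaceOf L i).adicCompletion (maximalRealSubfield L))ˣ) :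
        (basePlaceOf L i).adicCompletion (maximalRealSubfield L)) ∈ U1 (x₀ i) (r i) →
      χ (RestrictedProduct.mulSingle (genLevel L) i g) = 1)
  (VS : ∀ i, i ∈ S → IsSplitPlace L i →
    (Lp ℂ 2 (Adic.muV (maximalRealSubfield L) (basePlaceOf L i)) →ₗᵢ[ℂ] Sp))
  (hVSψ : ∀ i (hi : i ∈ S) (hs : IsSplitPlace L i),
    VS i hi hs (a i • ballIndicator (Adic.muV (maximalRealSubfield L) (basePlaceOf L i)) (x₀ i) (r i)) = φ)
  (hVS : ∀ i (hi : i ∈ S) (hs : IsSplitPlace L i), ∀ g : locTorus (maximalRealSubfield L) L i,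
    D.ω (RestrictedProduct.mulSingle (genLevel L) i g)
        (VS i hi hs (a i • ballIndicator (Adic.muV (maximalRealSubfield L) (basePlaceOf L i)) (x₀ i) (r i)))
      = VS i hi hs (dilationRep (Adic.muV (maximalRealSubfield L) (basePlaceOf L i)) (ν i) (baseTriv L i hs g)
          (a i • ballIndicator (Adic.muV (maximalRealSubfield L) (basePlaceOf L i)) (x₀ i) (r i))))
  -- non-split `v ∈ S` (every infinite place included): isotypy of `φ`
  (hiso : ∀ i ∈ S, ¬IsSplitPlace L i → ∀ g : locTorus (maximalRealSubfield L) L i, D.ω (RestrictedProduct.mulSingle (genLevel L) i g) φ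
    = conj (((χ (RestrictedProduct.mulSingle (genLevel L) i g) : Circle) : ℂ)) • φ)

include hW hh hj hχΓ hχVΓ P hφ hloc hK hM hTS hT'S hS hν hVUψ hVU hr hr0 hνS hχS hVSψ hVS hiso

set_option synthInstance.maxHeartbeats 200000 in
-- (as in #1/#2: the `SMul Γ (Model L)` instance behind `IsFundamentalDomain` is slow to find at these concrete types)
/-- **S3 HEADLINE for the genuine unitary torus `U(1)_{L/L⁺}(𝔸_{L⁺}) ⊇ U(1)(L⁺)` of a CM field `L`, split
places read in the BASE completions `U(1)_v ≅ (L⁺_v)ˣ` (tex l. 610 `L_{0,v}^×` to the letter, `L_0 = L ∩ ℝ = L⁺`)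
through ISOMETRIC INTERTWINERS (ll. 610–611).**  pv09-g4's `exists_compactDomain_thetaLift_ne_zero_of_model` with `L₀ := L⁺`,
`w := basePlaceOf`, `τ := baseTriv` (pv07-g3 `splitEquivBaseCM`), `ord / ϖ / ϖF` DERIVED from the chart
(pv13-g3 `ordOfIdent` / `unifOfIdent`, `Adic.exists_isUniformizer`), the dictionary equations DERIVED from the
intertwiners, and every other place-side binder discharged as in #1. -/
theorem exists_compactDomain_thetaLift_ne_zero_genuine_base [IsFiniteMeasure GU.μ] :
    ∃ 𝓕 : Set (Model L), IsCompact 𝓕 ∧ (interior 𝓕).Nonempty ∧ MeasurableSet 𝓕 ∧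
      IsFundamentalDomain (unitaryToModel L).range 𝓕 (haarDatum (genLevel L) (isCompact_genLevel L) (isOpen_genLevel L) S₀).μ ∧
      (haarDatum (genLevel L) (isCompact_genLevel L) (isOpen_genLevel L) S₀).μ 𝓕 ≠ 0 ∧
      (haarDatum (genLevel L) (isCompact_genLevel L) (isOpen_genLevel L) S₀).μ 𝓕 ≠ ⊤ ∧
      ∀ [IsFiniteMeasure (((haarDatum (genLevel L) (isCompact_genLevel L) (isOpen_genLevel L) S₀).μ).restrict 𝓕)]
        (hk : Measurable (Function.uncurry (thetaFn D GU φ))) {Ck : ℝ} (hCk : 0 ≤ Ck)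
        (hkC : ∀ q u, ‖thetaFn D GU φ q u‖ ≤ Ck),
        PeterssonFubini.theta GU.μ (((haarDatum (genLevel L) (isCompact_genLevel L) (isOpen_genLevel L) S₀).μ).restrict 𝓕) hk
          (measurable_coe_char (genLevel L) (isOpen_genLevel L) χ hχT' hlocχ) hCk hkC (norm_coe_char_le χ) ≠ 0 := by
  -- the identification as a bare group isomorphism, and its level property `τ(B_v) = 𝒪_vˣ`
  let τU : ∀ i, i ∉ S → IsSplitPlace L i →
      (locTorus (maximalRealSubfield L) L i ≃* ((basePlaceOf L i).adicCompletion (maximalRealSubfield L))ˣ) :=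
    fun i _ hs => (baseTriv L i hs).toMulEquiv
  have hτUB : ∀ i (hi : i ∉ S) (hs : IsSplitPlace L i), ∀ g : locTorus (maximalRealSubfield L) L i,
      g ∈ genLevel L i ↔ ‖((τU i hi hs g : ((basePlaceOf L i).adicCompletion (maximalRealSubfield L))ˣ) :
        (basePlaceOf L i).adicCompletion (maximalRealSubfield L))‖ = 1 :=
    fun i _ hs g => mem_genLevel_iff_norm_baseTriv_eq_one L i hs g
  exact exists_compactDomain_thetaLift_ne_zero_of_model (genLevel L) (isCompact_genLevel L) (isOpen_genLevel L) S₀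
    hW hh D GU (maximalRealSubfield L) L (unitaryToModel L) (unitaryToModel_injective L)
    (torusEquiv (maximalRealSubfield L) L).symm (torusEquiv_symm_unitaryToModel_mem L)
    (fun _ ha => torusEquiv_mem_range_unitaryToModel L ha) j hj χ hχΓ hχVΓ P φ hφ hloc hχT' hlocχ hK hM hTS hT'S
    (maximalRealSubfield L) (basePlaceOf L) (basePlaceOf_injOn L hS) ν
    (fun i _ hs => coe_genLevel_eq_univ L i hs)
    (ordOfIdent S (IsSplitPlace L) (maximalRealSubfield L) (basePlaceOf L) (fun i => baseUnifF L (basePlaceOf L i))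
      (fun i _ => isUniformizer_baseUnifF L (basePlaceOf L i)) τU)
    (unifOfIdent S (IsSplitPlace L) (maximalRealSubfield L) (basePlaceOf L) (fun i => baseUnifF L (basePlaceOf L i)) τU)
    (fun i => baseUnifF L (basePlaceOf L i)) (fun i _ => isUniformizer_baseUnifF L (basePlaceOf L i))
    (ordOfIdent_unif S (IsSplitPlace L) (maximalRealSubfield L) (basePlaceOf L) (fun i => baseUnifF L (basePlaceOf L i))
      (fun i _ => isUniformizer_baseUnifF L (basePlaceOf L i)) τU)
    (ordOfIdent_eq_one_iff (genLevel L) S (IsSplitPlace L) (maximalRealSubfield L) (basePlaceOf L) (fun i => baseUnifF L (basePlaceOf L i))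
      (fun i _ => isUniformizer_baseUnifF L (basePlaceOf L i)) τU hτUB)
    hν
    (fun i hi hs n => coeff_zpow_of_intertwiner (genLevel L) D.ω φ
      (Adic.muV (maximalRealSubfield L) (basePlaceOf L i)) (ν i) i (τU i hi hs).toMonoidHom
      (unifOfIdent S (IsSplitPlace L) (maximalRealSubfield L) (basePlaceOf L) (fun i => baseUnifF L (basePlaceOf L i)) τU i)
      (baseUnifF L (basePlaceOf L i))
      (τU_unifOfIdent S (IsSplitPlace L) (maximalRealSubfield L) (basePlaceOf L) (fun i => baseUnifF L (basePlaceOf L i)) τU i hi hs)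
      1 (VU i hi hs)
      (hVUψ i hi hs) (hVU i hi hs) n)
    (fun i _ hs => baseTriv L i hs) x₀ r (fun i => ‖a i‖ ^ 2) hr hr0
    (fun i hi hs => normSq_pos_of_map_smul_eq (VS i hi hs) (hVSψ i hi hs) hφ) hνS hχS
    (fun i hi hs g => coeffS_of_intertwiner (genLevel L) D.ω φ
      (Adic.muV (maximalRealSubfield L) (basePlaceOf L i)) (ν i) i (fun g => baseTriv L i hs g) (x₀ i) (r i) (a i)
      (VS i hi hs) (hVSψ i hi hs) (hVS i hi hs) g)
    (fun i _ hs => compactSpace_of_not_isSplitPlace L i hs) hiso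

end genuineBase

end HodgeCM.PerL34.PureTensor

end
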